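import Summits.Ventures.PercRepro.Night2LocalD3Loss
import Summits.Ventures.PercRepro.Night2LocalDQPenultA

/-!
# PercRepro — the cell `(a, k) = (3, 2)` at `|E ∖ G| = 3`, `q = 4`: thin losses and «at most one fat member» (night-2, gen 12)

The open cell `kColoops G = 2` of the regime `|E ∖ G| = 3` (`proofs/NIGHT-2-dq3.md` §5), at the far sets `S` with three
coloops: `coloops S = K ∪ {x}` (`K` the two coloops of `M|G`, `coloopsG_subset_coloops`), the non-coloops form a three-point
line, `|S| = 6`, and the three members carrying layer-2 weight are `B_u = K ∪ {x, u}`.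

* a thin member (`|G ∖ cl B| ≥ 3`) loses at most `4/45` (`loss_le_d3_thin`), so `w₂ ≤ (8/45)/(|G ∖ cl B| − 1)` (`w2_le_d3_thin`);
* at most ONE of the three is fat (`not_two_fat_of_three_two`: two fat members put a point of `G ∖ S` in `cl(K ∪ {x})`, whose
  rank is `2 + ρ{x, p} = 4 > 3`);
The sequel `Night2LocalD3ThreeTwoB.lean` draws the consequences (a fat member forces `S ∖ x ∉ U_G`; the column bound at
the far sets with `S ∖ x ∉ U_G`).
-/

open scoped Matroid

namespace PercRepro.Shadow

open Finset PerFlat ThmH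

variable {α : Type*} [DecidableEq α] {M : Matroid α} [M.Finite]

section Thin

variable {G S : Finset α}

open scoped Classical in
/-- A thin member (`|G ∖ cl B| ≥ 3`) requests at most `1/5` at `d = 3`. -/
theorem req_le_fifth_of_three_le (hG : G ∈ flatsQ M (4 + 1)) (hd : (gr M \ G).card = 3) {B : Finset α}
    (hB : B ∈ membersIn M (Uq M (4 + 2) 4) G) (hm : 3 ≤ (G \ clF M B).card) : req M 4 B ≤ 1 / 5 := by
  have hBG : clF M B ⊆ G := (mem_membersIn.1 hB).2
  have hc : (gr M \ clF M B).card = (G \ clF M B).card + 3 := by rw [card_compl_clF_add hG hBG, hd]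
  unfold req
  have h6 : (6 : ℚ) ≤ ((gr M \ clF M B).card : ℚ) := by
    rw [hc]; push_cast
    have : (3 : ℚ) ≤ ((G \ clF M B).card : ℚ) := by exact_mod_cast hm
    linarith
  have hphi : phiQ 4 = 6 / 5 := by unfold phiQ; norm_num
  rw [hphi, div_le_iff₀ (by linarith)]
  linarith

open scoped Classical in
/-- A thin member loses at most `(1/5)·(4/9) = 4/45` at `d = 3`. -/
theorem loss_le_d3_thin (hG : G ∈ flatsQ M (4 + 1)) (hd : (gr M \ G).card = 3) {B : Finset α}
    (hB : B ∈ membersIn M (Uq M (4 + 2) 4) G) (hB0 : B ∉ lay0 M 4 G) (hm : 3 ≤ (G \ clF M B).card) {z : α}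
    (hz : z ∈ G \ clF M B) : loss M 4 G B z ≤ 4 / 45 := by
  have hS : insert z B ∈ shadowAt M (4 + 2) 4 (Uq M (4 + 2) 4) G :=
    insert_mem_shadowAt (Finset.Subset.refl _) hG hB hz
  have hSG : insert z B ⊆ G := subset_of_mem_shadowAt hS
  have hk2 : k1 M 4 G (insert z B) ≤ 2 := by
    have h1 := k1_le_kColoops (M := M) (q := 4) hSG
    have h2 := kColoops_add_one_le_of_not_lay0 hG hd (by norm_num) hB hB0
    omega
  set S' := insert z B with hSdef
  set j := k1 M 4 G S' with hjdef
  have hj' : (j : ℚ) ≤ 2 := by exact_mod_cast hk2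
  have hj0 : (0 : ℚ) ≤ (j : ℚ) := by positivity
  have hLmax : (0 : ℚ) < (5 - (j : ℚ)) * (6 / 25) := by nlinarith
  have hcapS : capS M 4 G S' = 1 - (j : ℚ) * (3 / 10) := by
    unfold capS; rw [hd]; unfold phiQ; push_cast; ring
  have hcap0 : 0 ≤ capS M 4 G S' := capS_nonneg hG (by omega) hSG
  have hreq : req M 4 B ≤ 1 / 5 := req_le_fifth_of_three_le hG hd hB hm
  have hL1 : L1 M 4 G S' ≤ (5 - (j : ℚ)) * (6 / 25) := L1_le_d3_of_k1 hG hd hS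
  have harith := lossFrac_arith_d3 hk2
  unfold loss fS
  split_ifs with hle
  · rw [sub_self, mul_zero]; norm_num
  · push Not at hle
    have hLpos : 0 < L1 M 4 G S' := hcap0.trans_lt hle
    have h1 : 1 - capS M 4 G S' / L1 M 4 G S' = (L1 M 4 G S' - capS M 4 G S') / L1 M 4 G S' := by field_simp
    rw [h1]
    calc req M 4 B * ((L1 M 4 G S' - capS M 4 G S') / L1 M 4 G S')
        ≤ (1 / 5) * ((L1 M 4 G S' - capS M 4 G S') / L1 M 4 G S') := by
          apply mul_le_mul_of_nonneg_right hreq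
          exact div_nonneg (by linarith) hLpos.le
      _ ≤ (1 / 5) * (((5 - (j : ℚ)) * (6 / 25) - capS M 4 G S') / ((5 - (j : ℚ)) * (6 / 25))) := by
          apply mul_le_mul_of_nonneg_left _ (by norm_num)
          exact ratio_mono hcap0 hLpos hL1
      _ ≤ (1 / 5) * (4 / 9) := by
          apply mul_le_mul_of_nonneg_left _ (by norm_num)
          rw [hcapS]; exact harith
      _ = 4 / 45 := by norm_num

open scoped Classical in
/-- A thin member carrying layer-2 weight has `w₂(B, S) ≤ (8/45)/(|G ∖ cl B| − 1) ≤ 4/45`. -/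
theorem w2_le_d3_thin (hG : G ∈ flatsQ M (4 + 1)) (hd : (gr M \ G).card = 3) {B : Finset α}
    (hB : B ∈ ex2 M 4 G S) (hm : 3 ≤ (G \ clF M B).card) : w2 M 4 G B S ≤ 4 / 45 := by
  obtain ⟨hBm, hB0, hBS, hsub, hcard⟩ := mem_ex2_unpack hB
  have hden : (2 : ℚ) ≤ ((G \ clF M B).card : ℚ) - 1 := by
    have : (3 : ℚ) ≤ ((G \ clF M B).card : ℚ) := by exact_mod_cast hm
    linarith
  have hsum : ∑ z ∈ S \ B, loss M 4 G B z ≤ 8 / 45 := by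
    calc ∑ z ∈ S \ B, loss M 4 G B z ≤ ∑ _z ∈ S \ B, (4 : ℚ) / 45 :=
          Finset.sum_le_sum (fun z hz => loss_le_d3_thin hG hd hBm hB0 hm (hsub hz))
      _ = 8 / 45 := by rw [Finset.sum_const, hcard, nsmul_eq_mul]; norm_num
  unfold w2
  rw [if_pos ⟨hB0, hBS, hsub, hcard⟩]
  calc (∑ z ∈ S \ B, loss M 4 G B z) / (((G \ clF M B).card : ℚ) - 1) ≤ (8 / 45) / 2 := by
        apply div_le_div₀ (by norm_num) hsum (by norm_num) hden
    _ = 4 / 45 := by norm_num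

end Thin

section ThreeTwo

variable {G S : Finset α}

open scoped Classical in
/-- With two coloops of `M|G` and three coloops of the shadow set `S`, the coloops of `S` are `K ∪ {x}` for a
single `x ∉ K` (`K = G.filter (coloop)`). -/
theorem exists_coloops_eq_insert (hS : S ∈ shadowAt M (4 + 2) 4 (Uq M (4 + 2) 4) G) (hk : kColoops M G = 2)
    (ha : (coloops M S).card = 3) :
    ∃ x, x ∉ G.filter (fun y => y ∉ clF M (G.erase y)) ∧
      coloops M S = insert x (G.filter (fun y => y ∉ clF M (G.erase y))) := by
  set K := G.filter (fun y => y ∉ clF M (G.erase y)) with hKdef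
  have hKsub : K ⊆ coloops M S := coloopsG_subset_coloops hS
  have hKc : K.card = 2 := by unfold kColoops at hk; rw [← hKdef] at hk; exact hk
  have hdiff : (coloops M S \ K).card = 1 := by
    have := Finset.card_sdiff_add_card_eq_card hKsub
    omega
  obtain ⟨x, hx⟩ := Finset.card_eq_one.1 hdiff
  have hxmem : x ∈ coloops M S \ K := by rw [hx]; exact Finset.mem_singleton_self x
  refine ⟨x, (Finset.mem_sdiff.1 hxmem).2, ?_⟩
  ext e
  constructor
  · intro he
    rw [Finset.mem_insert]
    by_cases heK : e ∈ K
    · exact Or.inr heK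
    · left
      have : e ∈ coloops M S \ K := Finset.mem_sdiff.2 ⟨he, heK⟩
      rw [hx, Finset.mem_singleton] at this
      exact this
  · intro he
    rw [Finset.mem_insert] at he
    rcases he with rfl | heK
    · exact (Finset.mem_sdiff.1 hxmem).1
    · exact hKsub heK

open scoped Classical in
/-- With three coloops of `S` and a member carrying layer-2 weight, `|S| = 6`: the non-coloops are a three-point line. -/
theorem card_eq_six_of_three (hs : ∀ e ∈ gr M, ∀ f ∈ gr M, e ≠ f → rkN M {e, f} = 2) (hG : G ∈ flatsQ M (4 + 1))
    (hS : S ∈ shadowAt M (4 + 2) 4 (Uq M (4 + 2) 4) G) (ha : (coloops M S).card = 3) {B : Finset α}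
    (hB : B ∈ ex2 M 4 G S) : S.card = 6 := by
  have hP := sdiff_mem_seriesPairs hG hS hB
  have h3 := card_nonColoops_eq_three hs hG hS (by rw [ha]) (by norm_num) hP
  have hsub : coloops M S ⊆ S := coloops_subset_self S
  have := Finset.card_sdiff_add_card_eq_card hsub
  unfold nonColoops at h3
  omega

open scoped Classical in
/-- The complement `S ∖ B` of a member carrying layer-2 weight consists of non-coloops of `S`. -/
theorem sdiff_subset_nonColoops_of_mem_ex2 (hG : G ∈ flatsQ M (4 + 1))
    (hS : S ∈ shadowAt M (4 + 2) 4 (Uq M (4 + 2) 4) G) {B : Finset α} (hB : B ∈ ex2 M 4 G S) :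
    S \ B ⊆ nonColoops M S := by
  have hSg : S ⊆ gr M := (subset_of_mem_shadowAt hS).trans (mem_flatsQ.1 hG).1
  have hr : rkN M S = 4 + 1 := rkN_eq_of_mem_shadowAt hS
  exact subset_nonColoops_of_mem_seriesPairs hSg hr (sdiff_mem_seriesPairs hG hS hB)

open scoped Classical in
/-- **At most one fat member at a far set with three coloops when `M|G` has two coloops**: two fat members `B₁ ≠ B₂`
put every point `p ∈ G ∖ S` into `cl(B₁ ∩ B₂) = cl(K ∪ {x})`, of rank `3`, while `K ∪ {x, p}` has rank `4`. -/
theorem not_two_fat_of_three_two (hs : ∀ e ∈ gr M, ∀ f ∈ gr M, e ≠ f → rkN M {e, f} = 2)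
    (hG : G ∈ flatsQ M (4 + 1)) (hd : (gr M \ G).card = 3) (hk : kColoops M G = 2)
    (hS : S ∈ shadowAt M (4 + 2) 4 (Uq M (4 + 2) 4) G) (ha : (coloops M S).card = 3) {B₁ B₂ : Finset α}
    (hB₁ : B₁ ∈ ex2 M 4 G S) (hB₂ : B₂ ∈ ex2 M 4 G S) (hne : B₁ ≠ B₂) (hf₁ : (G \ clF M B₁).card = 2)
    (hf₂ : (G \ clF M B₂).card = 2) : False := by
  set K := G.filter (fun y => y ∉ clF M (G.erase y)) with hKdef
  obtain ⟨x, hxK, hcol⟩ := exists_coloops_eq_insert hS hk ha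
  have hGg : G ⊆ gr M := (mem_flatsQ.1 hG).1
  have hSG : S ⊆ G := subset_of_mem_shadowAt hS
  have hS6 : S.card = 6 := card_eq_six_of_three hs hG hS ha hB₁
  obtain ⟨hB1m, -, hB1S, hsub1, hc1⟩ := mem_ex2_unpack hB₁
  obtain ⟨hB2m, -, hB2S, hsub2, hc2⟩ := mem_ex2_unpack hB₂
  have hP1 : S \ B₁ ⊆ nonColoops M S := sdiff_subset_nonColoops_of_mem_ex2 hG hS hB₁
  have hP2 : S \ B₂ ⊆ nonColoops M S := sdiff_subset_nonColoops_of_mem_ex2 hG hS hB₂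
  have hT3 : (nonColoops M S).card = 3 := by
    have hsub : coloops M S ⊆ S := coloops_subset_self S
    have := Finset.card_sdiff_add_card_eq_card hsub
    unfold nonColoops; omega
  -- the two complements are distinct 2-subsets of the 3-set of non-coloops: they meet in one point
  have hPne : S \ B₁ ≠ S \ B₂ := by
    intro h
    apply hne
    calc B₁ = S \ (S \ B₁) := (Finset.sdiff_sdiff_eq_self hB1S).symm
      _ = S \ (S \ B₂) := by rw [h]
      _ = B₂ := Finset.sdiff_sdiff_eq_self hB2S
  have hunion : (S \ B₁) ∪ (S \ B₂) ⊆ nonColoops M S := Finset.union_subset hP1 hP2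
  have hcu : ((S \ B₁) ∪ (S \ B₂)).card ≤ 3 := hT3 ▸ Finset.card_le_card hunion
  have hci := Finset.card_union_add_card_inter (S \ B₁) (S \ B₂)
  have hint1 : 1 ≤ ((S \ B₁) ∩ (S \ B₂)).card := by omega
  have hint2 : ((S \ B₁) ∩ (S \ B₂)).card ≤ 1 := by
    by_contra hlt
    push Not at hlt
    have h2 : ((S \ B₁) ∩ (S \ B₂)).card = 2 := by
      have := Finset.card_le_card (Finset.inter_subset_left (s₁ := S \ B₁) (s₂ := S \ B₂)); omega
    have heq : (S \ B₁) ∩ (S \ B₂) = S \ B₁ :=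
      Finset.eq_of_subset_of_card_le Finset.inter_subset_left (by omega)
    have heq' : (S \ B₁) ∩ (S \ B₂) = S \ B₂ :=
      Finset.eq_of_subset_of_card_le Finset.inter_subset_right (by omega)
    exact hPne (heq.symm.trans heq')
  obtain ⟨t₀, ht₀⟩ := Finset.card_eq_one.1 (le_antisymm hint2 hint1)
  have ht₀mem : t₀ ∈ (S \ B₁) ∩ (S \ B₂) := by rw [ht₀]; exact Finset.mem_singleton_self t₀
  have ht₀S : t₀ ∈ S := (Finset.mem_sdiff.1 (Finset.mem_inter.1 ht₀mem).1).1
  have ht₀c : t₀ ∉ coloops M S := by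
    intro h
    have : t₀ ∈ nonColoops M S := hP1 (Finset.mem_inter.1 ht₀mem).1
    unfold nonColoops at this
    exact (Finset.mem_sdiff.1 this).2 h
  -- `B₁ ∪ B₂ = S ∖ t₀` is independent; `B₁ ∩ B₂ = coloops S`
  have hI : M.Indep ((S.erase t₀ : Finset α) : Set α) := indep_erase_of_not_coloop hG hS hS6 ht₀S ht₀c
  have hB1I : B₁ ⊆ S.erase t₀ := by
    intro e he
    rw [Finset.mem_erase]
    refine ⟨?_, hB1S he⟩
    rintro rfl
    exact (Finset.mem_sdiff.1 (Finset.mem_inter.1 ht₀mem).1).2 he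
  have hB2I : B₂ ⊆ S.erase t₀ := by
    intro e he
    rw [Finset.mem_erase]
    refine ⟨?_, hB2S he⟩
    rintro rfl
    exact (Finset.mem_sdiff.1 (Finset.mem_inter.1 ht₀mem).2).2 he
  have hunion3 : ((S \ B₁) ∪ (S \ B₂)).card = 3 := by omega
  have hTeq : (S \ B₁) ∪ (S \ B₂) = nonColoops M S :=
    Finset.eq_of_subset_of_card_le hunion (by omega)
  have hinter : B₁ ∩ B₂ = coloops M S := by
    ext e
    rw [Finset.mem_inter]
    constructor
    · rintro ⟨he1, he2⟩
      by_contra hec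
      have : e ∈ nonColoops M S := by
        unfold nonColoops; exact Finset.mem_sdiff.2 ⟨hB1S he1, hec⟩
      rw [← hTeq, Finset.mem_union, Finset.mem_sdiff, Finset.mem_sdiff] at this
      rcases this with h | h
      · exact h.2 he1
      · exact h.2 he2
    · intro he
      exact ⟨mem_of_mem_ex2_of_mem_coloops hG hS hB₁ he, mem_of_mem_ex2_of_mem_coloops hG hS hB₂ he⟩
  -- a point of `G ∖ S` lies in both closures
  obtain ⟨p, hpG, hpS⟩ := exists_mem_sdiff_of_mem_ex2 hG hd hS hB₁
  have hp1 : p ∈ clF M B₁ := by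
    by_contra h
    have hmem : p ∈ G \ clF M B₁ := Finset.mem_sdiff.2 ⟨hpG, h⟩
    rw [(Finset.eq_of_subset_of_card_le hsub1 (by omega)).symm] at hmem
    exact hpS (Finset.mem_sdiff.1 hmem).1
  have hp2 : p ∈ clF M B₂ := by
    by_contra h
    have hmem : p ∈ G \ clF M B₂ := Finset.mem_sdiff.2 ⟨hpG, h⟩
    rw [(Finset.eq_of_subset_of_card_le hsub2 (by omega)).symm] at hmem
    exact hpS (Finset.mem_sdiff.1 hmem).1
  have hpcl : p ∈ clF M (coloops M S) := by
    rw [← hinter]; exact mem_clF_inter_of_indep hI hB1I hB2I hp1 hp2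
  rw [hcol] at hpcl
  -- ranks: `K ∪ {x}` has rank `3`, `K ∪ {x, p}` has rank `4`
  have hxS : x ∈ S := coloops_subset_self S (by rw [hcol]; exact Finset.mem_insert_self x _)
  have hxG : x ∈ G := hSG hxS
  have hxp : x ≠ p := by rintro rfl; exact hpS hxS
  have hpK : p ∉ K := fun h => hpS (coloops_subset_self S (coloopsG_subset_coloops hS h))
  have hY : ∀ y ∈ K, y ∈ G ∧ y ∉ clF M (G.erase y) := fun y hy => Finset.mem_filter.1 hy
  have hr1 : M.eRk ((K ∪ {x} : Finset α) : Set α) = (K.card : ℕ∞) + M.eRk (({x} : Finset α) : Set α) :=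
    eRk_union_coloops hGg K hY (Finset.singleton_subset_iff.2 hxG) (Finset.disjoint_singleton_right.2 hxK)
  have hr2 : M.eRk ((K ∪ {x, p} : Finset α) : Set α) = (K.card : ℕ∞) + M.eRk (({x, p} : Finset α) : Set α) := by
    apply eRk_union_coloops hGg K hY
    · intro e he
      rw [Finset.mem_insert, Finset.mem_singleton] at he
      rcases he with rfl | rfl
      · exact hxG
      · exact hpG
    · rw [Finset.disjoint_insert_right, Finset.disjoint_singleton_right]
      exact ⟨hxK, hpK⟩
  have hxrk : rkN M ({x} : Finset α) ≤ 1 := (rkN_le_card _).trans (by simp)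
  have hxprk : rkN M ({x, p} : Finset α) = 2 := hs x (hGg hxG) p (hGg hpG) hxp
  have hr1' : rkN M (K ∪ {x}) ≤ K.card + 1 := by
    rw [eRk_eq_rkN, eRk_eq_rkN] at hr1
    have : rkN M (K ∪ {x}) = K.card + rkN M {x} := by exact_mod_cast hr1
    omega
  have hr2' : rkN M (K ∪ {x, p}) = K.card + 2 := by
    rw [eRk_eq_rkN, eRk_eq_rkN] at hr2
    have : rkN M (K ∪ {x, p}) = K.card + rkN M {x, p} := by exact_mod_cast hr2
    omega
  have hins : rkN M (insert p (insert x K)) ≤ rkN M (insert x K) :=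
    rkN_insert_le_of_mem_clF (Finset.insert_subset (hGg hxG) ((Finset.filter_subset _ _).trans hGg)) hpcl
  have he2 : insert p (insert x K) = K ∪ {x, p} := by
    ext e; simp only [Finset.mem_insert, Finset.mem_union, Finset.mem_singleton]; tauto
  have he1 : insert x K = K ∪ {x} := by
    ext e; simp only [Finset.mem_insert, Finset.mem_union, Finset.mem_singleton]; tauto
  rw [he2, he1] at hins
  omega

end ThreeTwo

end PercRepro.Shadow
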